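import Literature.Analysis.FluidPDE.TaoAveragedSobolevProofs
import HarnessLib

/-!
# Barrier: Type-I blow-up for an autonomous averaged Navier–Stokes equation obeying the energy identity

Barrier catalogue entry for `NavierStokesRegularity` (D-0021). The main declaration
`AveragedTypeIBlowup` is the **Type-I / autonomous sharpening of T. Tao's Theorem 1.5** (J. Amer.
Math. Soc. 29 (2016); catalogue entry `TaoAveragedBlowup`): *there exist a symmetric averaging
datum `𝒜` with the cancellation property — Tao's class (1.12)–(1.16), in the tree the accepted
`Literature.Analysis.FluidPDE.Tao2016.AveragingDatum` with `IsSymmetric`, `HasCancellation`,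
`IsMildSolution` — a Schwartz divergence-free datum `u₀`, a time `T > 0` and an `H¹⁰_df`-mild
solution `u` of the (autonomous) averaged Navier–Stokes equation `∂ₜu = Δu + B̃(u,u)` on `[0,T)`
obeying the Type-I rate `‖u(t)‖_{L^∞} ≤ M (T - t)^{-1/2}` and admitting NO mild extension past `T`
agreeing with `u` on `[0,T)`.*

## Provenance (read this first): a theorem of the tree, not a printed theorem

Tao's Theorem 1.5 produces a blow-up of **Type II** and leaves the Type-I tier open: "it is not
obvious to the author whether the main results in [ESS] extend to averaged Navier–Stokes
equations. [Footnote:] This would not be in contradiction to Theorem 1.5, as the blowup solution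
constructed in the proof of that theorem is of 'Type II' in the sense that critical norms of the
solution `u(t)` diverge in the limit `t → T_*`. In contrast, the results in [ESS] rules out
'Type I' blowup, in which a certain critical norm stays bounded." [Tao 2016, §1.1 p. 8 and
footnote]. No published source proves the statement of this entry. It is a **machine-checked
theorem of this tree**, proved Summits-side as crux #3 of the (refuted-by-design) route
`PerpetualPump` of `NavierStokesRegularity`:

* statement: `Summit.NavierStokesRegularity.NavierStokesRegularity.Theses.PerpetualPump.AveragedTypeIBlowup`
  (item stmt-NavierStokesRegularity-1835) — the body of `AveragedTypeIBlowup` below is that term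
  VERBATIM (fully qualified), so the two agree by `Iff.rfl`;
* proof: `Summit.NavierStokesRegularity.NavierStokesRegularity.Theorems.PerpetualPumpAveragedTypeIBlowup.AveragedTypeIBlowup_of`
  (`Summits/NavierStokesRegularity/NavierStokesRegularity/Theorems/PerpetualPumpAveragedTypeIBlowup*.lean`,
  @ 124e2660af92), axiom closure `{propext, Classical.choice, Quot.sound}` — **no `sorryAx`** —
  re-checked with `#print axioms` on 2026-08-17 by the seat vending this entry (the docstring of
  `AveragedTypeIBlowup_of` still speaks of `stub_*` sorries; all seven stubs have since landed);
* consequence: `Summit.NavierStokesRegularity.NavierStokesRegularity.Theorems.not_Thesis`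
  (`PerpetualPumpThesisRefutation.lean`): ABSTRACT TYPE-I EXCLUSION over Tao's class — the route
  target `Theses.PerpetualPump.Thesis` = `∀ 𝒜, 𝒜.IsSymmetric → 𝒜.HasCancellation →
  AveragedTypeI.ExcludesTypeI 𝒜` in the vocabulary below (again `Iff.rfl`) — is FALSE.

Because Literature never imports `Summits` (CONVENTIONS §2), the discharge
`theorem AveragedTypeIBlowup_holds : AveragedTypeIBlowup := AveragedTypeIBlowup_of` cannot live in
this directory; it is a one-line Summits-side `Theorems/` file for a prover (the identification is
`Iff.rfl`). Until it lands the entry is, formally, a named fact; every consequence in this file is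
proved from `(h : AveragedTypeIBlowup)` or is pure vocabulary.

Mechanism of the tree's proof (for `because:`): a symmetric cancelling LOCAL CASCADE operator
(Tao Def. 3.1, p. 14) at arbitrarily fine dyadic parameter `ε₀` — an `m = 2` "seeded graded
Toda" circuit, i.e. a choice of Tao's structure constants `α_{i₁,i₂,i₃,μ₁,μ₂,μ₃}` with his
symmetry and cancellation conditions (§4, Lemma 4.1 and the viscous model system displayed after
its proof, pp. 21–23) — whose EXACT mode dynamics (the Duhamel/Volterra chain of Lemma 4.1 with
the heat-kernel memory kept, not the model ODE) has a pinned, non-extendable staircase running at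
the Type-I pace (`stub_threshold`, `stub_chainContinuation`); synthesis of the `H¹⁰_df`-mild
solution and its `L^∞` rate from the wavelet modes (`stub_synthField`, `stub_synthMild`,
`stub_supBound`, `stub_modeNormBound`); non-extension from the divergence of the `H¹⁰` weight
(`stub_noext`); and transfer to an averaging datum through Tao's Theorem 3.2 "local cascade
operators are averaged Euler operators", itself a theorem of the tree
(`Literature.Analysis.FluidPDE.Tao2016.localCascade_isAveraged_holds`) (`stub_transfer`).

## Vocabulary introduced here (predicates with explicit binders — not named facts)

* `AveragedTypeI.HasTypeIRate T u` — the `L^∞` Type-I rate on `[0,T)` of Koch–Nadirashvili–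
  Seregin–Šverák: `sup_x |u(x,t)| ≤ C/√(T-t)` [KNSS 2009, §1 (definition of type I)];
* `AveragedTypeI.HasMildExtension 𝒜 u₀ T u` — a mild solution on some `[0,T')`, `T' > T`, from the
  same datum, agreeing with `u` on `[0,T)`;
* `AveragedTypeI.ExcludesTypeI 𝒜` — *Type-I exclusion for the averaged equation driven by `𝒜`*:
  every `H¹⁰_df`-mild solution from Schwartz divergence-free data at the Type-I rate on `[0,T)`
  extends past `T`. The BLOCKED STATEMENT of this barrier is `∀ 𝒜, 𝒜.IsSymmetric →
  𝒜.HasCancellation → ExcludesTypeI 𝒜` ("abstract", i.e. averaging-insensitive, Type-I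
  exclusion); it is kept as an explicit formula rather than a closed `Prop` definition because it is
  false (`AveragedTypeIBlowup.not_forall_excludesTypeI`) and a closed false `def … : Prop` would read
  as literature debt. Its instance at the Euler datum (`excludesTypeI_euler_iff`) is forward Type-I
  exclusion for the true Navier–Stokes equations (`ν = 1`, Tao's projected form (1.5)/(1.6)) in the
  `H¹⁰_df`-mild class — an open problem [KNSS 2009, §1].

## What is printed (sources actually read for this entry; page numbers of the held texts)

* T. Tao, arXiv:1402.0290v3 = J. Amer. Math. Soc. 29 (2016): Thm. 1.5 (p. 7); §1.1 p. 8 with its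
  footnote (Type II witness; whether [ESS] extends to averaged equations is "not obvious"; the
  barrier "does not rule out arguments that crucially exploit specific properties of the
  Navier–Stokes equation that are not shared by the averaged versions", naming the backward
  uniqueness argument of [ESS], which "relies on being able to control the nonlinearity pointwise
  in terms of the solution and its first derivatives … in vorticity formulation", and the
  slowly-varying large data of Chemin–Gallagher–Paicu, "which relies on certain delicate algebraic
  properties of the symbol of `B`"); §3 p. 14, Def. 3.1 and Thm. 3.2 (local cascade operators are
  averaged Euler operators); §4 Lemma 4.1 (equations of motion, p. 21) and the inviscid / viscous
  model systems displayed after its proof (p. 23; the viscous one "generalises the dyadic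
  Katz–Pavlović equation … with `λ = (1+ε₀)^{5/2}` and `α = 2/5`"); §4 Remark 4.3 (pp. 23–24:
  helicity conservation can be enforced in Thm. 1.5; total momentum, angular momentum and
  vorticity are conserved by every local cascade equation).
* G. Koch, N. Nadirashvili, G. Seregin, V. Šverák, arXiv:0709.3599 = Acta Math. 203 (2009): §1
  (pp. 3–4 of the arXiv text: type I means `sup_x|u(x,t)| ≤ C/√(T-t)`; the Liouville problem for
  bounded ancient mild solutions, "completely open" in 3-D; "some of [our results] are out of reach
  of the usual methods …, such as energy methods or perturbation analyses in various function
  spaces … because some special properties of solutions of scalar equations … cannot be detected at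
  the broad level at which the usual methods used for Navier–Stokes are applied"); §5 Thms. 5.1–5.3
  (Liouville theorems: 2-D; axisymmetric without swirl; axisymmetric with `|u| ≤ C/|x'|`, each via a
  scalar maximum principle); §6 Thms. 6.1–6.2 (axisymmetric singularities are of type II).
* D. Albritton, T. Barker, arXiv:1811.00502 = J. Math. Fluid Mech. 21 (2019): Thm. 1.1 (Type-I
  singular point of a suitable weak solution ⟺ non-trivial mild bounded ancient solution with
  Type-I decay) and Rem. 3.2 (p. 7: the `L^∞` formulation `sup √(-t)‖v(t)‖_∞ < ∞` "alone does not
  appear to guarantee" their rescaled-energy Type-I condition).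
* L. Escauriaza, G. Seregin, V. Šverák, Russ. Math. Surveys 58 (2003), Thms. 1.3–1.4 — cited as
  reported by Tao (§1.1 p. 8); not held.

## References

* T. Tao, *Finite time blowup for an averaged three-dimensional Navier–Stokes equation*, J. Amer.
  Math. Soc. 29 (2016), 601–674; arXiv:1402.0290. [`Tao2016AveragedNS`]
* G. Koch, N. Nadirashvili, G. A. Seregin, V. Šverák, *Liouville theorems for the Navier–Stokes
  equations and applications*, Acta Math. 203 (2009), 83–105; arXiv:0709.3599.
  [`KochNadirashviliSereginSverak2009`]
* D. Albritton, T. Barker, *On local Type I singularities of the Navier–Stokes equations and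
  Liouville theorems*, J. Math. Fluid Mech. 21 (2019); arXiv:1811.00502. [`AlbrittonBarker2019`]
* L. Escauriaza, G. Seregin, V. Šverák, Russ. Math. Surveys 58 (2003), 211–250.
  [`EscauriazaSereginSverak2003`]
* J.-Y. Chemin, I. Gallagher, M. Paicu, Ann. of Math. 173 (2011), 983–1012. [`CheminGallagherPaicu2011`]
-/

noncomputable section

namespace Literature.Barriers.NavierStokesRegularity

open _root_.MeasureTheory Set
open Literature.Analysis.FluidPDE Literature.Analysis.FluidPDE.Tao2016

/-! ## Vocabulary: the Type-I tier over Tao's averaging class -/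

namespace AveragedTypeI

/-- **The `L^∞` Type-I rate on `[0,T)`** for a trajectory `u : ℝ → L²(ℝ³; ℂ³)`:
`‖u(t)‖_{L^∞} ≤ M (T - t)^{-1/2}` for some `M` and all `t ∈ [0,T)` — "a singularity … at time `T`
is called type I if `sup_x|u(x,t)| ≤ C/√(T-t)`" (the rate of a self-similar singularity; Leray's
lower bound has the same shape). `eLpNorm · ⊤` of the `L²` class is the essential supremum.
[cite: KochNadirashviliSereginSverak2009, §1 (definition of type I / type II)] -/
def HasTypeIRate (T : ℝ) (u : ℝ → L2C) : Prop :=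
  ∃ M : ℝ, ∀ t ∈ Set.Ico 0 T, eLpNorm (u t) ⊤ volume ≤ ENNReal.ofReal (M / Real.sqrt (T - t))

/-- **Mild extension past `T`.** The `H¹⁰_df`-mild solution `u` of the averaged Navier–Stokes
equation driven by `𝒜` with datum `u₀` (Tao (1.15), `AveragingDatum.IsMildSolution`) on `[0,T)`
extends past `T`: there are `T' > T` and a mild solution `v` on `[0,T')` from the same datum with
`v = u` on `[0,T)`. (No uniqueness is built in; with Tao's `H¹⁰` local theory, p. 7, mild
solutions are unique, but that is not used here.) [cite: Tao2016AveragedNS, §1.1 (1.15) and p. 7] -/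
def HasMildExtension (𝒜 : AveragingDatum) (u₀ : L2C) (T : ℝ) (u : ℝ → L2C) : Prop :=
  ∃ T' : ℝ, T < T' ∧ ∃ v : ℝ → L2C, 𝒜.IsMildSolution u₀ (Set.Ico 0 T') v ∧ ∀ t ∈ Set.Ico 0 T, v t = u t

/-- **Type-I exclusion for the averaged Navier–Stokes equation driven by `𝒜`** (the `L^∞`-rate
tier): for every Schwartz divergence-free datum `u₀`, every `T > 0` and every `H¹⁰_df`-mild
solution `u` of `∂ₜu = Δu + B̃_𝒜(u,u)`, `u(0) = u₀` on `[0,T)` obeying the Type-I rate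
`‖u(t)‖_∞ ≤ M(T-t)^{-1/2}`, the solution extends as a mild solution past `T`. For the Euler datum
(`B̃ = B`, `AveragingDatum.euler_form`) this is forward Type-I exclusion for the Navier–Stokes
equations themselves in Tao's mild class (`excludesTypeI_euler_iff`), a statement for which no
proof is known (it would follow from a Liouville theorem for bounded ancient mild solutions,
known in 2-D and for axisymmetric flows without swirl; module docstring); the statement BLOCKED
by the entry `AveragedTypeIBlowup` is its averaging-insensitive form `∀ 𝒜, 𝒜.IsSymmetric →
𝒜.HasCancellation → ExcludesTypeI 𝒜`, which is refuted. A PREDICATE on the datum (explicit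
binder) — vocabulary, asserting nothing — not a named fact.
[cite: KochNadirashviliSereginSverak2009, §1 and Thms. 5.1–5.2] -/
def ExcludesTypeI (𝒜 : AveragingDatum) : Prop :=
  ∀ u₀ : SchwartzMap (EuclideanSpace ℝ (Fin 3)) (EuclideanSpace ℝ (Fin 3)),
    VectorCalculus.IsDivFree ⇑u₀ → ∀ T : ℝ, 0 < T → ∀ u : ℝ → L2C,
      𝒜.IsMildSolution (schwartzL2 u₀) (Set.Ico 0 T) u → HasTypeIRate T u →
        HasMildExtension 𝒜 (schwartzL2 u₀) T u

/-- A Type-I rate on `[0,T)` restricts to any earlier horizon `S ≤ T` with the same constant: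
`M/√(T-t) ≤ M/√(S-t)` for `t < S` once `M ≥ 0`, and `M ≥ 0` is forced as soon as `[0,S)` is
non-empty. [folklore] -/
theorem HasTypeIRate.mono {S T : ℝ} {u : ℝ → L2C} (h : HasTypeIRate T u) (hST : S ≤ T) :
    HasTypeIRate S u := by
  obtain ⟨M, hM⟩ := h
  refine ⟨max M 0, fun t ht => ?_⟩
  have htT : t ∈ Set.Ico 0 T := ⟨ht.1, ht.2.trans_le hST⟩
  refine (hM t htT).trans (ENNReal.ofReal_le_ofReal ?_)
  have hS : 0 < Real.sqrt (S - t) := Real.sqrt_pos.2 (by linarith [ht.2])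
  have hT : Real.sqrt (S - t) ≤ Real.sqrt (T - t) := Real.sqrt_le_sqrt (by linarith)
  calc M / Real.sqrt (T - t) ≤ max M 0 / Real.sqrt (T - t) :=
        div_le_div_of_nonneg_right (le_max_left _ _) (Real.sqrt_nonneg _)
    _ ≤ max M 0 / Real.sqrt (S - t) :=
        div_le_div_of_nonneg_left (le_max_right _ _) hS hT

/-- The zero trajectory has the Type-I rate (with `M = 0`): the rate hypothesis is not vacuous.
[folklore] -/
theorem hasTypeIRate_zero (T : ℝ) : HasTypeIRate T (fun _ => (0 : L2C)) := by
  refine ⟨0, fun t _ => ?_⟩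
  have h0 : eLpNorm ((0 : L2C) : EuclideanSpace ℝ (Fin 3) → EuclideanSpace ℂ (Fin 3)) ⊤
      (volume : Measure (EuclideanSpace ℝ (Fin 3))) = 0 := by
    rw [eLpNorm_congr_ae
      (Lp.coeFn_zero (EuclideanSpace ℂ (Fin 3)) 2 (volume : Measure (EuclideanSpace ℝ (Fin 3))))]
    exact eLpNorm_zero
  show eLpNorm ((0 : L2C) : EuclideanSpace ℝ (Fin 3) → EuclideanSpace ℂ (Fin 3)) ⊤
      (volume : Measure (EuclideanSpace ℝ (Fin 3))) ≤ _
  rw [h0]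
  exact zero_le

/-- The zero solution with zero datum extends past every horizon (by itself, on `[0, T+1)`;
`AveragingDatum.isMildSolution_zero`): the extension notion is not vacuous. [folklore] -/
theorem hasMildExtension_zero (𝒜 : AveragingDatum) (T : ℝ) :
    HasMildExtension 𝒜 0 T (fun _ => 0) :=
  ⟨T + 1, lt_add_one T, fun _ => 0, 𝒜.isMildSolution_zero _, fun _ _ => rfl⟩

end AveragedTypeI

/-! ## The entry -/

/-- **Barrier (this tree, 2026; the Type-I / autonomous sharpening of Tao 2016, Thm. 1.5):
Type-I blow-up for an autonomous averaged Navier–Stokes equation with the energy identity.**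
There exist a symmetric averaging datum `𝒜` with the cancellation property — Tao's class
(1.12)–(1.16): random real order-`0` Fourier multipliers with complex Hermitian symbols and moment
bounds, rotations in `SO(3)`, dilations `λ^{3/2}u(λ·)`, `λ ∈ [C⁻¹, C]`
(`Literature.Analysis.FluidPDE.Tao2016.AveragingDatum`, `IsSymmetric`, `HasCancellation`) — a
Schwartz divergence-free datum `u₀ : 𝓢(ℝ³, ℝ³)`, a time `T > 0` and an `H¹⁰_df`-mild solution
`u : [0,T) → H¹⁰_df(ℝ³)` of `∂ₜu = Δu + B̃(u,u)`, `u(0) = u₀` ((1.15), `IsMildSolution`) with the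
TYPE-I RATE `‖u(t)‖_{L^∞} ≤ M (T-t)^{-1/2}` on `[0,T)` and NO mild extension past `T` agreeing
with `u` on `[0,T)` (whence, granted Tao's `H¹⁰` local theory, p. 7, `sup_{t<T} ‖u(t)‖_{H¹⁰} = ∞`).
Equivalently (`averagedTypeIBlowup_iff`):
some symmetric cancelling datum violates `AveragedTypeI.ExcludesTypeI`. NOT IN PRINT — Tao's
witness is of Type II and he records that his construction does not decide the Type-I tier
[cite: Tao2016AveragedNS, §1.1 p. 8 and footnote]; PROVED IN THE TREE, Summits-side:
`Summit.NavierStokesRegularity.NavierStokesRegularity.Theorems.PerpetualPumpAveragedTypeIBlowup.AveragedTypeIBlowup_of`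
@ 124e2660af92 proves the route declaration `Theses.PerpetualPump.AveragedTypeIBlowup`
(stmt-NavierStokesRegularity-1835), whose term this body repeats verbatim (identification by
`Iff.rfl`); axiom closure `propext`/`Classical.choice`/`Quot.sound`, re-checked 2026-08-17. The
discharge `AveragedTypeIBlowup_holds` therefore belongs in a Summits-side `Theorems/` file
(Literature does not import Summits); this file proves only consequences of `(h : AveragedTypeIBlowup)`.
[cite: Tao2016AveragedNS, §1.1 Thm. 1.5 (p. 7) and footnote p. 8 (the Type-I question); §3 Thm. 3.2]

BARRIER (structured block, D-0021):
- technique_class: energy-identity harmonic-analysis abstract-bilinear-estimates function-space-estimates littlewood-paley H10-mild-local-theory besov-envelope autonomy rescaling-compactness type-I-exclusion self-similar-rate-exclusion abstract-liouville type-I-blowup-rate — the class of `TaoAveragedBlowup` ("strategies … based on treating the bilinear Euler operator `B` abstractly", using the cancellation `⟨B̃(u,u),u⟩ = 0` and the estimates `B̃` inherits from `B` in Sobolev `W^{s,p}` (`1 < p < ∞`), Hölder, Besov, Morrey spaces [cite: Tao2016AveragedNS, §1.1 pp. 6–8]) ENLARGED by everything that uses only that the equation is AUTONOMOUS (time-translation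 and dyadic-scaling covariance of one fixed `B̃`, hence rescaling/compactness arguments whose limit objects solve the same equation), when aimed at the weaker target "no blow-up at the Type-I rate `‖u(t)‖_∞ ≲ (T-t)^{-1/2}`" rather than at full regularity
- blocks: for NavierStokesRegularity (regularity side), every proof BY SUCH ARGUMENTS of Type-I exclusion at the `L^∞`-rate tier — formally: the statement `∀ 𝒜, 𝒜.IsSymmetric → 𝒜.HasCancellation → AveragedTypeI.ExcludesTypeI 𝒜` is false (`AveragedTypeIBlowup.not_forall_excludesTypeI`; Summits-side `Theorems.not_Thesis`), while its Euler instance `AveragedTypeI.ExcludesTypeI AveragingDatum.euler` is Navier–Stokes Type-I exclusion in Tao's mild class (`excludesTypeI_euler_of_forall`, `excludesTypeI_euler_iff`) — so an argument for "no Type-I blow-up for Navier–Stokes" (the conclusion that a Liouville theorem for bounded ancient mild solutions would give [cite: KochNadirashviliSereginSverak2009, §1 and §6] [cite: AlbrittonBarker2019, Thm. 1.1 and §1]) must use a property of `B` not shared by some symmetric cancelling `B̃`, or a Type-I hypothesis stronger than the `L^∞` rate; this is the RATE form of the Type-I tier that Tao's Type-II witness does not decide ("it is not obvious to the author whether the main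 results in [ESS] extend to averaged Navier–Stokes equations"; his footnote phrases Type I as "a certain critical norm stays bounded", for which see `scope_caveats` (ii)) [cite: Tao2016AveragedNS, §1.1 p. 8 and footnote], and it supplies, inside Tao's AUTONOMOUS class and at the `L^∞`-rate tier, the Type-I witness whose absence is recorded in this catalogue under `TaoAveragedBlowup` (`scope_caveats` (iii): Type-II witness) and under the exogenous, time-dependent facet `TruncatedDyadicTypeIBlowup` (`evasions_known`, last clause: whether averaging-insensitive but autonomy-using arguments can exclude Type-I blow-up was left undecided there)
- because: the tree's theorem `AveragedTypeIBlowup_of` (module docstring, *Provenance*): an `m = 2` seeded graded Toda LOCAL CASCADE operator (Tao's Def. 3.1 with structure constants obeying his symmetry and cancellation conditions) at arbitrarily fine dyadic parameter, whose exact Duhamel mode chain (Lemma 4.1, heat-kernel memory kept) carries a pinned non-extendable staircase at the Type-I pace; synthesis of the `H¹⁰_df`-mild solution with `‖u(t)‖_∞ ≤ M(T-t)^{-1/2}`; non-extension by divergence of the `H¹⁰` weight; transfer to a symmetric cancelling averaging datum by Tao's Thm. 3.2, "every local cascade operator (with dyadic scale parameter `ε₀` [a sufficiently small absolute constant]) is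 an averaged Euler bilinear operator", in tree `Tao2016.localCascade_isAveraged_holds` [cite: Tao2016AveragedNS, §3 Def. 3.1 and Thm. 3.2 (p. 14); §4 Lemma 4.1 (p. 21) and the viscous model system after it (p. 23)]; since the witness equation is autonomous, obeys the energy identity and inherits the function-space estimates of `B` [cite: Tao2016AveragedNS, §1.1 pp. 6–7], an argument in the blocked class would prove `ExcludesTypeI` for this datum, which is false
- evasions_known: arguments using fine structure of `B` not shared by the averages, as named by Tao for exactly this tier: regularity under a bounded critical norm via backward uniqueness / unique continuation for backwards heat equations, which "relies on being able to control the nonlinearity pointwise in terms of the solution and its first derivatives", a feature of the vorticity formulation that "does not hold in general" for averaged equations [cite: Tao2016AveragedNS, §1.1 p. 8] [cite: EscauriazaSereginSverak2003, Thms. 1.3–1.4 as reported by Tao 2016 §1.1 p. 8]; Liouville theorems for bounded ancient solutions proved through a SCALAR quantity obeying a maximum principle (2-D vorticity; `ω_θ/r` without swirl; `r u_θ` with swirl) — "special properties of solutions of scalar equations [that] cannot be detected at the broad level at which the usual methods used for Navier–Stokes are applied" — giving type II-only singularities for axisymmetric solutions [cite: KochNadirashviliSereginSverak2009, §1, Thms.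 5.1–5.3, 6.1–6.2] (catalogue `AxisymmetricTypeIExclusion`); Tao's other example of a structure-using argument, the slowly-varying large data of Chemin–Gallagher–Paicu resting on "delicate algebraic properties of the symbol of `B`", concerns global existence rather than Type I [cite: Tao2016AveragedNS, §1.1 p. 8] [cite: CheminGallagherPaicu2011, main theorem as reported by Tao 2016 §1.1 p. 8]. NOT evasions, as far as print goes: extra conservation laws — helicity conservation can be enforced in Thm. 1.5 (odd data), and total momentum, angular momentum and vorticity are conserved by every local cascade equation [cite: Tao2016AveragedNS, §4 Rem. 4.3 (pp. 23–24)] (printed for Tao's Type-II witness; for the Type-I witness see `scope_caveats` (iv))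
- scope_caveats: (i) ONE constructed datum `𝒜` and ONE Schwartz datum, as for Thm. 1.5; the estimate-inheritance that gives the entry its force is informal exactly as in `TaoAveragedBlowup` (i)–(ii) [cite: Tao2016AveragedNS, §1.1 pp. 6–7 and footnote p. 7]; (ii) "Type I" is the `L^∞`-IN-SPACE RATE `‖u(t)‖_∞ ≤ M(T-t)^{-1/2}` only — the notion of [cite: KochNadirashviliSereginSverak2009, §1 and Thm. 6.2]: nothing is asserted about the spatial envelope `|u| ≤ C/|x'|` [cite: KochNadirashviliSereginSverak2009, Thms. 5.3 and 6.1], mixed envelopes `(|x|+√(T-t))|u| ≤ C`, bounded scale-invariant norms `L^{3,∞}`, `L³`, `Ḃ^{-1+3/p}_{p,∞}` (the "certain critical norm stays bounded" of Tao's footnote and of [ESS]) or the rescaled-energy condition `𝐈 < ∞` — and the `L^∞` rate alone "does not appear to guarantee" the latter [cite: AlbrittonBarker2019, Rem. 3.2 (p. 7) and Thm. 1.1] [cite: Tao2016AveragedNS, §1.1 footnote p. 8] — nor is an ANCIENT Type-I solution of an averaged equation constructed here (the witness is a forward solution on `[0,T)` from Schwartz data), so Liouville statements for ancient solutions are addressed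 only through their standard consequence "no Type-I rate blow-up"; (iii) `H¹⁰_df`-mild solutions, Schwartz data, `ν = 1`, three dimensions, Tao's duality form (1.13)/(1.15) as rendered by `AveragingDatum` (see `TaoAveragedBlowup` (vi)); non-extension is "no mild extension agreeing with `u` on `[0,T)`", which needs no uniqueness theory and does not by itself assert `Tao2016.averagedNS_blowup` for this datum [cite: Tao2016AveragedNS, §1.1 (1.15) and p. 7]; (iv) the helicity-conserving modification of Rem. 4.3 is printed for Tao's construction; whether the tree's Type-I witness admits it is not established here [cite: Tao2016AveragedNS, §4 Rem. 4.3]; (v) NOT IN PRINT: the statement is this tree's theorem (`AveragedTypeIBlowup_of`, Summits-side, axioms `propext`/`Classical.choice`/`Quot.sound`); in this directory it is a named fact until the one-line Summits-side discharge `AveragedTypeIBlowup_holds` lands, and Tao in print claims only the Type-II Thm. 1.5 [cite: Tao2016AveragedNS, §1.1 Thm. 1.5 and footnote p. 8]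
- status: established — machine-checked in this tree (module docstring, *Provenance*); no dissent applicable -/
def AveragedTypeIBlowup : Prop :=
  ∃ 𝒜 : Literature.Analysis.FluidPDE.Tao2016.AveragingDatum, 𝒜.IsSymmetric ∧ 𝒜.HasCancellation ∧ ∃ u₀ : SchwartzMap (EuclideanSpace ℝ (Fin 3)) (EuclideanSpace ℝ (Fin 3)), Literature.Analysis.FluidPDE.VectorCalculus.IsDivFree ⇑u₀ ∧ ∃ T : ℝ, 0 < T ∧ ∃ u : ℝ → Literature.Analysis.FluidPDE.Tao2016.L2C, 𝒜.IsMildSolution (Literature.Analysis.FluidPDE.Tao2016.schwartzL2 u₀) (Set.Ico 0 T) u ∧ (∃ M : ℝ, ∀ t ∈ Set.Ico 0 T, MeasureTheory.eLpNorm (u t) ⊤ MeasureTheory.volume ≤ ENNReal.ofReal (M / Real.sqrt (T - t))) ∧ ¬ ∃ T' : ℝ, T < T' ∧ ∃ v : ℝ → Literature.Analysis.FluidPDE.Tao2016.L2C, 𝒜.IsMildSolution (Literature.Analysis.FluidPDE.Tao2016.schwartzL2 u₀) (Set.Ico 0 T') v ∧ ∀ t ∈ Set.Ico 0 T, v t =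 u t

/-- **Structured form of the entry**: `AveragedTypeIBlowup` says exactly that some symmetric
averaging datum with cancellation VIOLATES Type-I exclusion `AveragedTypeI.ExcludesTypeI`
(classical logic over the vocabulary above). [cite: Tao2016AveragedNS, §1.1 Thm. 1.5 and footnote p. 8] -/
theorem averagedTypeIBlowup_iff :
    AveragedTypeIBlowup ↔
      ∃ 𝒜 : AveragingDatum, 𝒜.IsSymmetric ∧ 𝒜.HasCancellation ∧ ¬ AveragedTypeI.ExcludesTypeI 𝒜 := by
  unfold AveragedTypeIBlowup AveragedTypeI.ExcludesTypeI AveragedTypeI.HasTypeIRate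
    AveragedTypeI.HasMildExtension
  constructor
  · rintro ⟨𝒜, hs, hc, u₀, hdiv, T, hT, u, hmild, hrate, hno⟩
    exact ⟨𝒜, hs, hc, fun h => hno (h u₀ hdiv T hT u hmild hrate)⟩
  · rintro ⟨𝒜, hs, hc, h⟩
    by_contra hcon
    refine h fun u₀ hdiv T hT u hmild hrate => ?_
    by_contra hext
    exact hcon ⟨𝒜, hs, hc, u₀, hdiv, T, hT, u, hmild, hrate, hext⟩

/-- **The barrier's content: abstract (averaging-insensitive) Type-I exclusion is false.** Given
the entry, it is NOT the case that every symmetric averaging datum with cancellation excludes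
Type-I blow-up — the negation of the route target `Theses.PerpetualPump.Thesis` of
`NavierStokesRegularity` (same term; Summits-side this is `Theorems.not_Thesis`). Hence any proof
of Navier–Stokes Type-I exclusion must leave the technique class (module docstring).
[cite: Tao2016AveragedNS, §1.1 p. 8 and footnote] -/
theorem AveragedTypeIBlowup.not_forall_excludesTypeI (h : AveragedTypeIBlowup) :
    ¬ ∀ 𝒜 : AveragingDatum, 𝒜.IsSymmetric → 𝒜.HasCancellation → AveragedTypeI.ExcludesTypeI 𝒜 := by
  obtain ⟨𝒜, hs, hc, hno⟩ := averagedTypeIBlowup_iff.mp h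
  exact fun hall => hno (hall 𝒜 hs hc)

/-- **The blocked class contains the Navier–Stokes equations themselves.** Abstract Type-I
exclusion over Tao's class specialises to the Euler datum (`mᵢ ≡ 1`, `Rᵢ = id`, `λᵢ = 1`, so
`B̃ = B`: `AveragingDatum.euler_form`), which is symmetric with cancellation
(`AveragingDatum.euler_isSymmetric`, `euler_hasCancellation`, i.e. Tao's (1.2)); so whoever proves
the averaging-insensitive statement proves Navier–Stokes Type-I exclusion — and conversely the
entry says that this road is closed. [cite: Tao2016AveragedNS, §1.1 (1.2), (1.13) and p. 8] -/
theorem AveragedTypeI.excludesTypeI_euler_of_forall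
    (h : ∀ 𝒜 : AveragingDatum, 𝒜.IsSymmetric → 𝒜.HasCancellation → AveragedTypeI.ExcludesTypeI 𝒜) :
    AveragedTypeI.ExcludesTypeI AveragingDatum.euler :=
  h _ AveragingDatum.euler_isSymmetric AveragingDatum.euler_hasCancellation

/-- The averaged form of the Euler datum IS the Euler trilinear form, as functions
(`AveragingDatum.euler_form` pointwise). [cite: Tao2016AveragedNS, §1.1 (1.13)] -/
theorem AveragedTypeI.euler_form_eq : AveragingDatum.euler.form = eulerForm :=
  funext fun u => funext fun v => funext fun w => AveragingDatum.euler_form u v w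

/-- Mild solutions of the averaged equation for the Euler datum are exactly the `H¹⁰_df`-mild
solutions of the (projected) Navier–Stokes equation `∂ₜu = Δu + B(u,u)` (Tao (1.5)/(1.6)).
[cite: Tao2016AveragedNS, §1.1 (1.5), (1.13), (1.15)] -/
theorem AveragedTypeI.isMildSolution_euler_iff (u₀ : L2C) (I : Set ℝ) (u : ℝ → L2C) :
    AveragingDatum.euler.IsMildSolution u₀ I u ↔ IsMildSolutionFor eulerForm u₀ I u := by
  unfold AveragingDatum.IsMildSolution
  rw [AveragedTypeI.euler_form_eq]

/-- **`ExcludesTypeI euler` is Navier–Stokes Type-I exclusion in Tao's mild class**, spelled out: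
every `H¹⁰_df`-mild solution of `∂ₜu = Δu + B(u,u)` (`ν = 1`) from a Schwartz divergence-free datum
obeying `‖u(t)‖_∞ ≤ M(T-t)^{-1/2}` on `[0,T)` extends as a mild solution past `T` — the
statement, not known to hold, that a Liouville theorem for bounded ancient mild solutions would imply.
[cite: KochNadirashviliSereginSverak2009, §1] -/
theorem AveragedTypeI.excludesTypeI_euler_iff :
    AveragedTypeI.ExcludesTypeI AveragingDatum.euler ↔
      ∀ u₀ : SchwartzMap (EuclideanSpace ℝ (Fin 3)) (EuclideanSpace ℝ (Fin 3)),
        VectorCalculus.IsDivFree ⇑u₀ → ∀ T : ℝ, 0 < T → ∀ u : ℝ → L2C,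
          IsMildSolutionFor eulerForm (schwartzL2 u₀) (Set.Ico 0 T) u →
            AveragedTypeI.HasTypeIRate T u →
              ∃ T' : ℝ, T < T' ∧ ∃ v : ℝ → L2C,
                IsMildSolutionFor eulerForm (schwartzL2 u₀) (Set.Ico 0 T') v ∧
                  ∀ t ∈ Set.Ico 0 T, v t = u t := by
  simp only [AveragedTypeI.ExcludesTypeI, AveragedTypeI.HasMildExtension,
    AveragedTypeI.isMildSolution_euler_iff]

end Literature.Barriers.NavierStokesRegularity

end
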